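import Summits.KontsevichZagierPeriods.KontsevichZagierPeriods.Theses.TerasomaMultiplication
import Literature.NumberTheory.Transcendental.KZSemialgebraicComplex
import Literature.NumberTheory.Transcendental.SemialgebraicLineDeriv
import Summits.KontsevichZagierPeriods.KontsevichZagierPeriods.Theorems.HermiteRigidityGenusTwoCycleTransferPushforwardDimOne
import Summits.KontsevichZagierPeriods.KontsevichZagierPeriods.Theorems.HermiteRigidityGenusTwoCycleTransferSemialgebraicInvFunOn
import Summits.KontsevichZagierPeriods.KontsevichZagierPeriods.Theorems.DasGapTwelve.Negative.LoadBearing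

/-!
# `DasGapTwelve` (stmt-KontsevichZagierPeriods-13215, route TerasomaMultiplication), line
`picard-involution-quotient`: stub T, `stub_twistNormalisation`

Untwisting the quartic twist `V² = x³ − D x`, `D = 3 + 2√3`, of `y² = x³ − x`: the representation
`ρ₃ = [{x | √D < x}, 2√3(√3+1)(x³ − D x)^(−1/2)]` on the unbounded real component is pushed forward
along the strictly decreasing `ℚ`-semialgebraic bijection `φ(x) = √(√D / x) : (√D, ∞) → (0, 1)`
(the composite of `x = √D·y` and `y = 1/s²`; inverse `s ↦ √D / s²`) by ONE instance of
Kontsevich–Zagier's rule (2) — the generic one-dimensional push-forward `stub_pushforwardDimOne`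
with the semialgebraic inverse of `stub_semialgebraicInvFunOn`. With `φ′ = −φ/(2x)` the pushed
integrand at `s = φ(x)` is `ρ₃.integrand(x)/|φ′(x)| = 4√3(√3+1)·D^(−1/4)·(1 − s⁴)^(−1/2)`, and the
exact constant identity `√2 · c₀ · D^(1/4) = √3(√3+1)` (`c₀ = 2^(−1/4)·3^(3/8)·√(1+√3)`,
`c₀⁴ = 9 + 6√3`; compare fourth powers: `4 c₀⁴ D = 252 + 144√3 = (3+√3)⁴`) turns it into
`4√2 · c₀ · (1 − s⁴)^(−1/2)`. Hence `ρ₄ = [(0,1), 4√2·c₀·(1 − s⁴)^(−1/2)]` exists (the push-forward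
itself) and `ρ₃ ~ ρ₄` for every representation pinned to these data (rule (1b) congruence
`KZ.of_sub_of_mem_relations_of_eqOn`).

References: M. Kontsevich, D. Zagier, *Periods* (2001), §1.2 rules (1), (2); J. Bochnak, M. Coste,
M.-F. Roy, *Real Algebraic Geometry* (1998), §2.2.
-/

noncomputable section

open Set MeasureTheory MvPolynomial
open Literature.NumberTheory.Transcendental Literature.ModelTheory.ExponentialFields

namespace Summit.KontsevichZagierPeriods.TerasomaMultiplication.DasGapTwelve

open Summit.KontsevichZagierPeriods.TerasomaMultiplication.DasGapTwelveNegative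
  (c₀ c₀_pos c₀_pow_four)
open Summit.KontsevichZagierPeriods.HermiteRigidity.GenusTwoCycleTransfer
  (stub_pushforwardDimOne stub_semialgebraicInvFunOn)

/-! ### Real algebra and analysis of the untwisting map `φ(x) = √(√D / x)` -/

/-- The exact constant identity of the untwisting: `√2 · c₀ · √(√D) = √3 · (√3 + 1)` with
`D = 3 + 2√3` (both sides are positive and their fourth powers are `4 c₀⁴ D = 4(9+6√3)(3+2√3)`
and `(3 + √3)⁴`, both equal to `252 + 144√3`). [folklore] -/
theorem twist_const_identity :
    Real.sqrt 2 * c₀ * Real.sqrt (Real.sqrt (3 + 2 * Real.sqrt 3)) =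
      Real.sqrt 3 * (Real.sqrt 3 + 1) := by
  have h3 : Real.sqrt 3 ^ 2 = 3 := Real.sq_sqrt (by norm_num)
  have h2 : Real.sqrt 2 ^ 2 = 2 := Real.sq_sqrt (by norm_num)
  have hD : (0:ℝ) ≤ 3 + 2 * Real.sqrt 3 := by positivity
  have ha : Real.sqrt (Real.sqrt (3 + 2 * Real.sqrt 3)) ^ 4 = 3 + 2 * Real.sqrt 3 := by
    rw [show (4:ℕ) = 2 * 2 from rfl, pow_mul, Real.sq_sqrt (Real.sqrt_nonneg _), Real.sq_sqrt hD]
  have h24 : Real.sqrt 2 ^ 4 = 4 := by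
    rw [show (4:ℕ) = 2 * 2 from rfl, pow_mul, h2]; norm_num
  have hl : 0 ≤ Real.sqrt 2 * c₀ * Real.sqrt (Real.sqrt (3 + 2 * Real.sqrt 3)) :=
    (mul_pos (mul_pos (Real.sqrt_pos.mpr two_pos) c₀_pos)
      (Real.sqrt_pos.mpr (Real.sqrt_pos.mpr (by positivity)))).le
  refine (pow_left_inj₀ hl (by positivity) (by norm_num : (4:ℕ) ≠ 0)).mp ?_
  rw [mul_pow, mul_pow, ha, c₀_pow_four, h24]
  linear_combination (-(Real.sqrt 3) ^ 6 - 4 * Real.sqrt 3 ^ 5 - 9 * Real.sqrt 3 ^ 4 -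
    16 * Real.sqrt 3 ^ 3 - 28 * Real.sqrt 3 ^ 2 - 48 * Real.sqrt 3 - 36) * h3

/-- The derivative of the untwisting map: `φ′(x) = −φ(x)/(2x)` for `x > √D`
(`φ = √(√D/x)`, chain rule with `(√D/x)′ = −√D/x²` and `φ² = √D/x`). [folklore] -/
theorem twist_hasDerivAt {x : ℝ} (hx : Real.sqrt (3 + 2 * Real.sqrt 3) < x) :
    HasDerivAt (fun y => Real.sqrt (Real.sqrt (3 + 2 * Real.sqrt 3) / y))
      (-(Real.sqrt (Real.sqrt (3 + 2 * Real.sqrt 3) / x) / (2 * x))) x := by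
  have ha : 0 < Real.sqrt (3 + 2 * Real.sqrt 3) := Real.sqrt_pos.mpr (by positivity)
  have hx0 : 0 < x := ha.trans hx
  have hax : 0 < Real.sqrt (3 + 2 * Real.sqrt 3) / x := div_pos ha hx0
  have h1 : HasDerivAt (fun y => Real.sqrt (3 + 2 * Real.sqrt 3) / y)
      ((0 * x - Real.sqrt (3 + 2 * Real.sqrt 3) * 1) / x ^ 2) x :=
    (hasDerivAt_const x _).fun_div (hasDerivAt_id' (x := x)) hx0.ne'
  refine (h1.sqrt hax.ne').congr_deriv ?_
  set a : ℝ := Real.sqrt (3 + 2 * Real.sqrt 3) with ha_def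
  set s : ℝ := Real.sqrt (a / x) with hs_def
  have hs : 0 < s := Real.sqrt_pos.mpr hax
  have hs2 : s ^ 2 = a / x := Real.sq_sqrt hax.le
  have hax' : a = s ^ 2 * x := by rw [hs2]; field_simp
  rw [hax']
  field_simp
  ring

/-- `φ′(x) = −φ(x)/(2x) ≠ 0` for `x > √D`. [folklore] -/
theorem twist_deriv_ne_zero {x : ℝ} (hx : Real.sqrt (3 + 2 * Real.sqrt 3) < x) :
    -(Real.sqrt (Real.sqrt (3 + 2 * Real.sqrt 3) / x) / (2 * x)) ≠ 0 := by
  have ha : 0 < Real.sqrt (3 + 2 * Real.sqrt 3) := Real.sqrt_pos.mpr (by positivity)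
  have hx0 : 0 < x := ha.trans hx
  exact neg_ne_zero.mpr (div_pos (Real.sqrt_pos.mpr (div_pos ha hx0)) (by positivity)).ne'

/-- `φ` is injective on `(√D, ∞)` (indeed `φ(x) = φ(y)` forces `√D/x = √D/y`). [folklore] -/
theorem twist_injective {x y : ℝ} (hx : Real.sqrt (3 + 2 * Real.sqrt 3) < x)
    (hy : Real.sqrt (3 + 2 * Real.sqrt 3) < y)
    (h : Real.sqrt (Real.sqrt (3 + 2 * Real.sqrt 3) / x) =
      Real.sqrt (Real.sqrt (3 + 2 * Real.sqrt 3) / y)) : x = y := by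
  have ha : 0 < Real.sqrt (3 + 2 * Real.sqrt 3) := Real.sqrt_pos.mpr (by positivity)
  have hx0 : 0 < x := ha.trans hx
  have hy0 : 0 < y := ha.trans hy
  have h1 := (Real.sqrt_inj (div_pos ha hx0).le (div_pos ha hy0).le).mp h
  rw [div_eq_div_iff hx0.ne' hy0.ne'] at h1
  exact (mul_left_cancel₀ ha.ne' h1).symm

/-- **The pushed-forward integrand.** For `x > √D` and `s = φ(x) = √(√D/x)`:
`2√3(√3+1)(x³ − Dx)^(−1/2) / |φ′(x)| = 4√2·c₀·(1 − s⁴)^(−1/2)`. Indeed `s⁴ = D/x²`,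
`x³ − Dx = x(x² − D)`, so both sides are `4√3(√3+1)·x/(√(x²−D)·√(√D))` resp. `4√2·c₀·x/√(x²−D)`,
equal by `twist_const_identity`. [folklore] -/
theorem twist_pushed_integrand {x : ℝ} (hx : Real.sqrt (3 + 2 * Real.sqrt 3) < x) :
    2 * Real.sqrt 3 * (Real.sqrt 3 + 1) * (x ^ 3 - (3 + 2 * Real.sqrt 3) * x) ^ (-(1:ℝ)/2) /
        |-(Real.sqrt (Real.sqrt (3 + 2 * Real.sqrt 3) / x) / (2 * x))| =
      4 * Real.sqrt 2 * c₀ *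
        (1 - Real.sqrt (Real.sqrt (3 + 2 * Real.sqrt 3) / x) ^ 4) ^ (-(1:ℝ)/2) := by
  have key := twist_const_identity
  have hD : (0:ℝ) < 3 + 2 * Real.sqrt 3 := by positivity
  set D : ℝ := 3 + 2 * Real.sqrt 3 with hD_def
  set a : ℝ := Real.sqrt D with ha_def
  have ha : 0 < a := Real.sqrt_pos.mpr hD
  have ha2 : a ^ 2 = D := Real.sq_sqrt hD.le
  have hx0 : 0 < x := ha.trans hx
  have hxD : D < x ^ 2 := (Real.sqrt_lt' hx0).mp hx
  have hx2D : 0 < x ^ 2 - D := sub_pos.mpr hxD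
  have hb : 0 < Real.sqrt a := Real.sqrt_pos.mpr ha
  have hu : 0 < Real.sqrt x := Real.sqrt_pos.mpr hx0
  have hv : 0 < Real.sqrt (x ^ 2 - D) := Real.sqrt_pos.mpr hx2D
  have h2 : 0 < Real.sqrt 2 := Real.sqrt_pos.mpr two_pos
  -- `φ(x) = √a/√x`, `1 - φ(x)⁴ = (x² - D)/x²`, `x³ - Dx = x (x² - D)`
  rw [Real.sqrt_div' a hx0.le]
  have h1s4 : 1 - (Real.sqrt a / Real.sqrt x) ^ 4 = (x ^ 2 - D) / x ^ 2 := by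
    rw [div_pow, show (4:ℕ) = 2 * 2 from rfl, pow_mul, pow_mul, Real.sq_sqrt ha.le,
      Real.sq_sqrt hx0.le, ha2]
    field_simp
  have hcub : x ^ 3 - D * x = x * (x ^ 2 - D) := by ring
  have hφ : 0 < Real.sqrt a / Real.sqrt x / (2 * x) := by positivity
  rw [h1s4, hcub, abs_neg, abs_of_pos hφ, neg_div, Real.rpow_neg (mul_pos hx0 hx2D).le,
    Real.rpow_neg (div_pos hx2D (pow_pos hx0 2)).le, ← Real.sqrt_eq_rpow, ← Real.sqrt_eq_rpow,
    Real.sqrt_mul hx0.le, Real.sqrt_div' _ (pow_pos hx0 2).le, Real.sqrt_sq hx0.le]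
  -- substitute `c₀ = √3(√3+1)/(√2 · √a)`; what is left is an identity of rational functions
  have hc : c₀ = Real.sqrt 3 * (Real.sqrt 3 + 1) / (Real.sqrt 2 * Real.sqrt a) := by
    rw [eq_div_iff (mul_pos h2 hb).ne', ← key]
    ring
  rw [hc]
  field_simp
  ring

/-- The image of `{p | √D < p 0}` under `p ↦ (φ (p 0))` is `{q | q 0 ∈ (0,1)}`: `0 < φ < 1` on
`(√D, ∞)`, and `s ∈ (0,1)` is `φ(√D/s²)` with `√D/s² > √D`. [folklore] -/
theorem twist_image_eq {σ : Set (Fin 1 → ℝ)}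
    (hσ : σ = {p | Real.sqrt (3 + 2 * Real.sqrt 3) < p 0}) :
    (fun p : Fin 1 → ℝ => fun _ : Fin 1 => Real.sqrt (Real.sqrt (3 + 2 * Real.sqrt 3) / p 0)) '' σ =
      {q | q 0 ∈ Ioo (0:ℝ) 1} := by
  have ha : 0 < Real.sqrt (3 + 2 * Real.sqrt 3) := Real.sqrt_pos.mpr (by positivity)
  ext q
  constructor
  · rintro ⟨p, hp, rfl⟩
    rw [hσ] at hp
    have hp' : Real.sqrt (3 + 2 * Real.sqrt 3) < p 0 := hp
    have hx0 : 0 < p 0 := ha.trans hp'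
    refine ⟨Real.sqrt_pos.mpr (div_pos ha hx0), ?_⟩
    show Real.sqrt (Real.sqrt (3 + 2 * Real.sqrt 3) / p 0) < 1
    rw [Real.sqrt_lt' one_pos, one_pow, div_lt_one hx0]
    exact hp'
  · rintro ⟨hq0, hq1⟩
    refine ⟨fun _ => Real.sqrt (3 + 2 * Real.sqrt 3) / (q 0) ^ 2, ?_, ?_⟩
    · rw [hσ]
      show Real.sqrt (3 + 2 * Real.sqrt 3) < Real.sqrt (3 + 2 * Real.sqrt 3) / (q 0) ^ 2
      rw [lt_div_iff₀ (pow_pos hq0 2)]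
      have hq2 : (q 0) ^ 2 < 1 := pow_lt_one₀ hq0.le hq1 two_ne_zero
      nlinarith
    · funext i
      rw [Fin.fin_one_eq_zero i]
      show Real.sqrt (Real.sqrt (3 + 2 * Real.sqrt 3) /
        (Real.sqrt (3 + 2 * Real.sqrt 3) / (q 0) ^ 2)) = q 0
      rw [div_div_cancel₀ ha.ne', Real.sqrt_sq hq0.le]

/-! ### The rule-2 push-forward of `ρ₃` along `φ` -/

/-- **The untwisting move.** For `ρ₃` pinned to `[{√D < x}, 2√3(√3+1)(x³ − Dx)^(−1/2)]` there is a
representation `s` with domain `{q | q 0 ∈ (0,1)}`, integrand `4√2·c₀·(1 − (q 0)⁴)^(−1/2)` on it,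
and `[ρ₃] − [s] ∈ KZ.changeOfVariablesRel`: the rule-2 push-forward of `ρ₃` along
`p ↦ (φ (p 0))` (`stub_pushforwardDimOne`, inverse by `stub_semialgebraicInvFunOn`), its integrand
computed by `twist_pushed_integrand`. [cite: KontsevichZagier2001, §1.2 rule (2)] -/
theorem twist_pushforward (ρ₃ : KZ.IntegralRep 1)
    (hd : ρ₃.domain = {x | Real.sqrt (3 + 2 * Real.sqrt 3) < x 0})
    (hi : EqOn ρ₃.integrand (fun x => 2 * Real.sqrt 3 * (Real.sqrt 3 + 1) *
      ((x 0) ^ 3 - (3 + 2 * Real.sqrt 3) * x 0) ^ (-(1:ℝ)/2)) ρ₃.domain) :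
    ∃ s : KZ.IntegralRep 1, s.domain = {x | x 0 ∈ Ioo (0:ℝ) 1} ∧
      EqOn s.integrand (fun x => 4 * Real.sqrt 2 * c₀ * (1 - (x 0) ^ 4) ^ (-(1:ℝ)/2)) s.domain ∧
      KZ.of ρ₃ - KZ.of s ∈ KZ.changeOfVariablesRel := by
  have hσ : IsSemialgebraic ℚ ρ₃.domain := ρ₃.isSemialgebraic_domain
  have hmem : ∀ p : Fin 1 → ℝ, p ∈ ρ₃.domain ↔ Real.sqrt (3 + 2 * Real.sqrt 3) < p 0 :=
    fun p => by rw [hd]; rfl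
  have ha : 0 < Real.sqrt (3 + 2 * Real.sqrt 3) := Real.sqrt_pos.mpr (by positivity)
  have hpos : ∀ p ∈ ρ₃.domain, 0 < p 0 := fun p hp => ha.trans ((hmem p).1 hp)
  -- `φ`, `φ′` are `ℚ`-semialgebraic on the domain
  have hx : IsSemialgebraicFunOn ℚ ρ₃.domain (fun p => p 0) :=
    (isSemialgebraicFunOn_aeval hσ (X 0 : MvPolynomial (Fin 1) ℚ)).congr fun p _ => by simp
  have h3 := isSemialgebraicFunOn_const_ofNat hσ 3
  have h2 := isSemialgebraicFunOn_const_ofNat hσ 2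
  have hA : IsSemialgebraicFunOn ℚ ρ₃.domain (fun _ => Real.sqrt (3 + 2 * Real.sqrt 3)) :=
    (h3.fun_add (h2.fun_mul h3.fun_sqrt)).fun_sqrt
  have hφ : IsSemialgebraicFunOn ℚ ρ₃.domain
      (fun p => Real.sqrt (Real.sqrt (3 + 2 * Real.sqrt 3) / p 0)) :=
    (hA.div hx fun p hp => (hpos p hp).ne').fun_sqrt
  have hφ' : IsSemialgebraicFunOn ℚ ρ₃.domain
      (fun p => -(Real.sqrt (Real.sqrt (3 + 2 * Real.sqrt 3) / p 0) / (2 * p 0))) :=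
    (hφ.div (h2.fun_mul hx) fun p hp => mul_ne_zero two_ne_zero (hpos p hp).ne').fun_neg
  -- `Φ : p ↦ (φ (p 0))` is an injective semialgebraic map with semialgebraic inverse
  have hΦsa : IsSemialgebraicMapOn ℚ ρ₃.domain (fun (p : Fin 1 → ℝ) (_ : Fin 1) =>
      Real.sqrt (Real.sqrt (3 + 2 * Real.sqrt 3) / p 0)) :=
    IsSemialgebraicMapOn.of_forall hσ fun _ => hφ
  have hΦinj : InjOn (fun (p : Fin 1 → ℝ) (_ : Fin 1) =>
      Real.sqrt (Real.sqrt (3 + 2 * Real.sqrt 3) / p 0)) ρ₃.domain := by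
    intro p hp p' hp' h
    have h0 := twist_injective ((hmem p).1 hp) ((hmem p').1 hp') (congrFun h 0)
    funext i
    rw [Fin.fin_one_eq_zero i]
    exact h0
  have hG := stub_semialgebraicInvFunOn hΦsa hΦinj
  have hGφ : ∀ p ∈ ρ₃.domain, Function.invFunOn (fun (p : Fin 1 → ℝ) (_ : Fin 1) =>
      Real.sqrt (Real.sqrt (3 + 2 * Real.sqrt 3) / p 0)) ρ₃.domain
        (fun _ => Real.sqrt (Real.sqrt (3 + 2 * Real.sqrt 3) / p 0)) = p :=
    fun p hp => hΦinj.leftInvOn_invFunOn hp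
  -- the rule-2 push-forward
  obtain ⟨s, hsd, hsi, hrel⟩ := stub_pushforwardDimOne ρ₃
    (fun y => Real.sqrt (Real.sqrt (3 + 2 * Real.sqrt 3) / y))
    (fun y => -(Real.sqrt (Real.sqrt (3 + 2 * Real.sqrt 3) / y) / (2 * y)))
    (Function.invFunOn (fun (p : Fin 1 → ℝ) (_ : Fin 1) =>
      Real.sqrt (Real.sqrt (3 + 2 * Real.sqrt 3) / p 0)) ρ₃.domain)
    hφ hφ' (fun p hp => twist_hasDerivAt ((hmem p).1 hp))
    (fun p hp => twist_deriv_ne_zero ((hmem p).1 hp)) hG hGφ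
  refine ⟨s, hsd.trans (twist_image_eq hd), fun q hq => ?_, hrel⟩
  rw [hsd] at hq
  obtain ⟨p, hp, rfl⟩ := hq
  show s.integrand (fun _ => Real.sqrt (Real.sqrt (3 + 2 * Real.sqrt 3) / p 0)) =
    4 * Real.sqrt 2 * c₀ *
      (1 - Real.sqrt (Real.sqrt (3 + 2 * Real.sqrt 3) / p 0) ^ 4) ^ (-(1:ℝ)/2)
  rw [hsi p hp, hi hp]
  exact twist_pushed_integrand ((hmem p).1 hp)

/-! ### Stub T -/

/-- Stub T (untwisting the `j = 1728` quartic twist `V² = w³ − D w`): the scalings `x = √D·y`,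
`y = 1/s²` (composed into the single rule-2 move `s = √(√D/x)`) and the exact constant identity
`4√3(√3+1)D^(−1/4) = 4√2·c₀` give
`[(√D,∞), 2√3(√3+1)(x³ − D x)^(−1/2)] ~ [(0,1), 4√2·c₀·(1 − s⁴)^(−1/2)]`, and the latter
representation exists. [cite: KontsevichZagier2001, §1.2 rule (2)] -/
theorem stub_twistNormalisation :
    ∀ (ρ₃ : Literature.NumberTheory.Transcendental.KZ.IntegralRep 1), ρ₃.domain = {x | Real.sqrt (3 + 2 * Real.sqrt 3) < x 0} → Set.EqOn ρ₃.integrand (fun x => 2 * Real.sqrt 3 * (Real.sqrt 3 + 1) * ((x 0) ^ 3 - (3 + 2 * Real.sqrt 3) * x 0) ^ (-(1:ℝ)/2)) ρ₃.domain → (∃ ρ₄ : Literature.NumberTheory.Transcendental.KZ.IntegralRep 1, ρ₄.domain = {x | x 0 ∈ Set.Ioo (0:ℝ) 1} ∧ Set.EqOn ρ₄.integrand (fun x => 4 * Real.sqrt 2 * ((2:ℝ) ^ (-(1:ℝ)/4) * (3:ℝ) ^ ((3:ℝ)/8) * Real.sqrt (1 + Real.sqrt 3)) * (1 - (x 0)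 ^ 4) ^ (-(1:ℝ)/2)) ρ₄.domain) ∧ ∀ (ρ₄ : Literature.NumberTheory.Transcendental.KZ.IntegralRep 1), ρ₄.domain = {x | x 0 ∈ Set.Ioo (0:ℝ) 1} → Set.EqOn ρ₄.integrand (fun x => 4 * Real.sqrt 2 * ((2:ℝ) ^ (-(1:ℝ)/4) * (3:ℝ) ^ ((3:ℝ)/8) * Real.sqrt (1 + Real.sqrt 3)) * (1 - (x 0) ^ 4) ^ (-(1:ℝ)/2)) ρ₄.domain → Literature.NumberTheory.Transcendental.KZ.Equivalent ρ₃ ρ₄ := by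
  intro ρ₃ hd hi
  obtain ⟨s, hsd, hsi, hrel⟩ := twist_pushforward ρ₃ hd hi
  refine ⟨⟨s, hsd, hsi⟩, fun ρ₄ h4d h4i => ?_⟩
  have h₁ : KZ.of ρ₃ - KZ.of s ∈ KZ.relations := KZ.changeOfVariablesRel_subset_relations hrel
  have h₂ : KZ.of s - KZ.of ρ₄ ∈ KZ.relations := by
    refine KZ.of_sub_of_mem_relations_of_eqOn (h4d.trans hsd.symm) fun q hq => ?_
    have hq' : q ∈ ρ₄.domain := by rw [h4d, ← hsd]; exact hq
    exact (hsi hq).trans (h4i hq').symm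
  have : KZ.of ρ₃ - KZ.of ρ₄ = (KZ.of ρ₃ - KZ.of s) + (KZ.of s - KZ.of ρ₄) :=
    (sub_add_sub_cancel _ _ _).symm
  show KZ.of ρ₃ - KZ.of ρ₄ ∈ KZ.relations
  rw [this]
  exact KZ.relations.add_mem h₁ h₂

end Summit.KontsevichZagierPeriods.TerasomaMultiplication.DasGapTwelve

end
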